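import Summits.ResolutionOfSingularities.ResolutionOfSingularities.Theorems.WeightedInvariantOpenSubschemeChart
import Summits.ResolutionOfSingularities.ResolutionOfSingularities.Theorems.WeightedInvariantOrbitCentreRegular
import Summits.ResolutionOfSingularities.ResolutionOfSingularities.Theorems.WeightedInvariantOrbitClosureRegular
import Summits.ResolutionOfSingularities.ResolutionOfSingularities.Theorems.WeightedInvariantOrbitCentreHomogeneousMaxSing
import Summits.ResolutionOfSingularities.ResolutionOfSingularities.Theorems.WeightedInvariantELadderOneProductCentre
import Summits.ResolutionOfSingularities.ResolutionOfSingularities.Theorems.WeightedInvariantELadderOneDropTransport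
import Summits.ResolutionOfSingularities.ResolutionOfSingularities.Theorems.WeightedInvariantELadderOneAQSHypotheses
import Summits.ResolutionOfSingularities.ResolutionOfSingularities.Theorems.WeightedInvariantLexMaxCentreTransport
import Summits.ResolutionOfSingularities.ResolutionOfSingularities.Theorems.WeightedInvariantWeightedConstructionCobordantBlowupRegular
import Summits.ResolutionOfSingularities.ResolutionOfSingularities.Theorems.WeightedInvariantRegularSubschemeCentre
import Literature.AlgebraicGeometry.Resolution.HypersurfaceHeightTwoWeightedCentre
import Literature.AlgebraicGeometry.Resolution.StalkIdealLemmas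
import HarnessLib

/-!
# Rung `e = 1` of the door: the centre of a singular stage (`stub_e1_centre`)

Route `ResolutionOfSingularities/WeightedInvariant`, door crux `HypersurfaceCentreConstruction`
(stmt-ResolutionOfSingularities-19897) — OURS; e-ladder `e = 1`, the registered stub **`stub_e1_centre`** of
`res-L1-w43-stub-10` (door skeleton v3.6 of res-L1-w43-plan-1; cell res-hironaka,
`D/res-D-pv-025/DOOR-ELADDER-PLAN.md` §8 «E1-ASSEMBLY»), closed BY NAME, MODULO the two vendored
Abramovich–Quek–Schober facts `AbramovichQuekSchober2025_heightTwoCentre` / `…_separableBaseChange`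
(arXiv:2507.01232, Thm 1.3 (1)(3), Thm 3.5 [cite: AbramovichQuekSchober2025]) taken as hypotheses exactly as
registered.

ASSEMBLY (plan §8 A1–A5):
* A1 the hypotheses of the fact at a maximal singular point `η` (regular 2-dimensional ambient stalk = (I1);
  `X_η` principal, non-zero, not a `(y^ν)`) — `Stage.aqs_hypotheses_of_mem_maxSing` (res-type-047);
* A2 `exists_lexMax_chart_of_aqs` — the fact's chart `(V, R_V, U, u, w, ℓ)` read on `Y`: the germs
  `x = germ_η u` in `𝒪_{Y,η}` (sections of the open subscheme ARE sections of `Y` on `V.ι ''ᵁ U`) form the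
  lex-maximal centre germ of `X_η` (transport along `Scheme.Opens.stalkIso`, `LexMaxCentre.map_ringEquiv`);
* the ORBIT CENTRE `R_η = ReesAlgebraData.ofGermFiltration η (𝒥∙(x; w))` (p507610): A4 regular weighted
  centre = `Stage.isRegularWeightedCentre_ofGermFiltration` (p516028) with `hhom` := res-type-047's
  `isHomogeneous_germContractionIdeal_weightedMonomialIdeal` (p515852) and `hLT` := res-D-pv-036's
  `linearIndependent_toCotangent_of_mem_closure_orbit` (p516943); support `= closure {η} ⊆ singImage`;
  A3 (hom) for all chart gradings = res-type-047's `isHomogeneous_ofGermFiltration_weightedMonomialIdeal_piece_ideal`;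
* A5 the DROP RIDER over `η`: for every regular weighted centre `P` agreeing with `R_η` on the affine opens
  missing the other orbit closures and every Rees filtration `R'` with the pieces of `P`, the strict transform on
  `R'.plus` has order `< ord_η` over `η` — the fact's clause (3) transported by res-type-070's
  `DropTransport.idealOrder_strictTransformPlus_lt_of_local_basicOpen` (p516837) on a basic open `D(h) ∋ η` of
  the fact's chart avoiding the other orbit closures, where `P = R_η` IS the fact's Rees algebra
  (`germContractionIdeal_image_eq_piece_ideal`, p517978);
* `stub_e1_centre`: the product over the finitely many maximal singular points (res-D-pv-036's
  `exists_isAdmissibleCentre_support_eq_singImage_of_unitCharts_of_forall_exists`, p514289, with (I2w)) is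
  admissible with support `singImage`, and the rider gives the drop at every point of `R'.plus` over `maxSing`.

Nothing here is a claim about Hironaka's problem or about any manuscript under adjudication; AI-written,
weaker than expert review.
-/

noncomputable section

set_option linter.dupNamespace false -- mandated namespace of this single-conjunct summit

open CategoryTheory AlgebraicGeometry TopologicalSpace IsLocalRing Opposite
open Literature.AlgebraicGeometry.Resolution
open Summit.ResolutionOfSingularities.ResolutionOfSingularities.Theorems

namespace Summit.ResolutionOfSingularities.ResolutionOfSingularities.Theorems.ELadderOne

/-! ## A2: the Abramovich–Quek–Schober chart at a point, read on the ambient scheme -/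

/-- **A2 — the lex-maximal chart at `η`, read on `Y`.**  Under the hypotheses of
`AbramovichQuekSchober2025_heightTwoCentre` at `η`, there are an open `V ∋ η`, a Rees algebra `R` on `V` with a
weighted chart `(U, u, w)` on an affine `U ∋ η` of `V`, supported on the closure of `η` in `V`, with the chartwise
order drop over `η`, such that the germs AT `η` IN `Y` of the `uᵢ` (sections of `Y` on the affine open
`V.ι ''ᵁ U`) with `(w, ℓ)` form the lex-maximal admissible weighted centre germ of `X_η ⊆ 𝒪_{Y,η}`.
[cite: AbramovichQuekSchober2025, Thm 1.3 (1)(3)] -/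
theorem exists_lexMax_chart_of_aqs (hAQS₁ : AbramovichQuekSchober2025_heightTwoCentre)
    {k : Type} [Field k] {Y : Scheme.{0}} (f : Y ⟶ Spec (.of k)) [LocallyOfFiniteType f]
    (X : Y.IdealSheafData) (η : Y) (hreg : IsRegularLocalRing (Y.presheaf.stalk η))
    (hdim : ringKrullDim (Y.presheaf.stalk η) = ((2 : ℕ) : WithBot ℕ∞))
    (hprinc : (stalkIdeal X η).IsPrincipal) (hne : stalkIdeal X η ≠ ⊥)
    (hnot : ∀ y ∈ maximalIdeal (Y.presheaf.stalk η), y ∉ maximalIdeal (Y.presheaf.stalk η) ^ 2 →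
      ∀ ν : ℕ, stalkIdeal X η ≠ Ideal.span {y ^ ν}) :
    ∃ (V : Y.Opens) (hηV : η ∈ V) (R : ReesAlgebraData (V : Scheme.{0}))
      (U : (V : Scheme.{0}).affineOpens)
      (hηU : (⟨η, hηV⟩ : (V : Scheme.{0})) ∈ (U : (V : Scheme.{0}).Opens))
      (u : Fin 2 → Γ((V : Scheme.{0}), U)) (w : Fin 2 → ℕ) (ℓ : ℕ),
      R.IsWeightedChart U u w ∧
      IsLexMaxWeightedCentreGerm (Y.presheaf.stalk η) (stalkIdeal X η)
        (fun i => (Y.presheaf.germ (V.ι ''ᵁ (U : (V : Scheme.{0}).Opens)) η ⟨⟨η, hηV⟩, hηU, rfl⟩).hom (u i))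
        w ℓ ∧
      R.support = closure {(⟨η, hηV⟩ : (V : Scheme.{0}))} ∧
      ∀ b : R.cobordantPlus U, R.cobordantPlusι U b = ⟨η, hηV⟩ →
        idealOrder (R.cobordantStrictTransform U (X.comap V.ι)) b < idealOrder X η := by
  obtain ⟨V, hηV, R, U, hηU, u, w, ℓ, hchart, hlex, -, hsupp, hdrop⟩ :=
    hAQS₁ k Y f X η hreg hdim hprinc hne (fun y hy hy2 => hnot y hy hy2)
  refine ⟨V, hηV, R, U, hηU, u, w, ℓ, hchart, ?_, hsupp, hdrop⟩
  -- transport of the lex-maximal germ along the stalk isomorphism of the open subscheme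
  let e : (V : Scheme.{0}).presheaf.stalk ⟨η, hηV⟩ ≃+* Y.presheaf.stalk η :=
    (V.stalkIso ⟨η, hηV⟩).commRingCatIsoToRingEquiv
  have he : (e : (V : Scheme.{0}).presheaf.stalk ⟨η, hηV⟩ →+* Y.presheaf.stalk η) =
      (V.stalkIso ⟨η, hηV⟩).hom.hom := rfl
  have h1 := LexMaxCentre.map_ringEquiv hlex e
  -- the ideal: `(X|_V)_η · e = X_η`
  have hI : (stalkIdeal (X.comap V.ι) ⟨η, hηV⟩).map
      (e : (V : Scheme.{0}).presheaf.stalk ⟨η, hηV⟩ →+* Y.presheaf.stalk η) = stalkIdeal X η := by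
    have h2 : stalkIdeal (X.comap V.ι) ⟨η, hηV⟩ = (stalkIdeal X η).map (V.stalkIso ⟨η, hηV⟩).inv.hom := by
      rw [stalkIdeal_comap_eq_map_stalkMap V.ι X ⟨η, hηV⟩, ← Scheme.Opens.stalkIso_inv]
      rfl
    have h3 : (V.stalkIso ⟨η, hηV⟩).hom.hom.comp (V.stalkIso ⟨η, hηV⟩).inv.hom = RingHom.id _ := by
      rw [← CommRingCat.hom_comp, Iso.inv_hom_id, CommRingCat.hom_id]
    rw [h2, Ideal.map_map, he, h3, Ideal.map_id]
  -- the germs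
  have hx : (fun i => e (((V : Scheme.{0}).presheaf.germ (U : (V : Scheme.{0}).Opens) ⟨η, hηV⟩ hηU).hom (u i))) =
      fun i => (Y.presheaf.germ (V.ι ''ᵁ (U : (V : Scheme.{0}).Opens)) η ⟨⟨η, hηV⟩, hηU, rfl⟩).hom (u i) := by
    funext i
    exact stalkIso_hom_germ V U ⟨η, hηV⟩ hηU (u i)
  rw [hI, hx] at h1
  exact h1

/-! ## The orbit centre at a maximal singular point, with its drop rider -/

namespace Stage

variable {k : Type} [Field k] (S : Stage k)

/-- A basic open `D(h) ∋ x` of an affine open `U` inside a given open neighbourhood `O ∋ x`. [folklore] -/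
theorem exists_basicOpen_le_of_mem {Z : Scheme.{0}} (U : Z.affineOpens) (O : Z.Opens) {x : Z}
    (hxU : x ∈ (U : Z.Opens)) (hxO : x ∈ O) :
    ∃ h : Γ(Z, U), Z.basicOpen h ≤ O ∧ x ∈ Z.basicOpen h :=
  U.2.exists_basicOpen_le ⟨x, hxO⟩ hxU

/-- **The orbit centre at a maximal singular point (A2–A5).**  Let `S` be a stage satisfying `Inv'` and
`η ∈ maxSing` a point at which the five hypotheses of the Abramovich–Quek–Schober fact hold.  ASSUMING the two
vendored facts, there is an admissible centre `R` for `(S.f, ker S.i)` with `R.support = closure {η}` carrying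
the DROP RIDER over `η`: for every regular weighted centre `P` on `Y` that agrees with `R` on every affine open
missing the closures of the other maximal singular points, and every Rees filtration `R'` with the pieces of
`P`, the strict transform of the hypersurface on `R'.plus` has order `< ord_η (ker S.i)` at every point over `η`.
[cite: AbramovichQuekSchober2025, Thm 1.3 (1)(3), Thm 3.5] -/
theorem exists_orbitCentre_of_aqs (hAQS₁ : AbramovichQuekSchober2025_heightTwoCentre)
    (hAQS₂ : AbramovichQuekSchober2025_separableBaseChange) (hInv : S.Inv') {η : S.Y} (hη : η ∈ S.maxSing)
    (hreg : IsRegularLocalRing (S.Y.presheaf.stalk η))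
    (hdim : ringKrullDim (S.Y.presheaf.stalk η) = ((2 : ℕ) : WithBot ℕ∞))
    (hprinc : (stalkIdeal S.i.ker η).IsPrincipal) (hne : stalkIdeal S.i.ker η ≠ ⊥)
    (hnot : ∀ y ∈ maximalIdeal (S.Y.presheaf.stalk η), y ∉ maximalIdeal (S.Y.presheaf.stalk η) ^ 2 →
      ∀ ν : ℕ, stalkIdeal S.i.ker η ≠ Ideal.span {y ^ ν}) :
    ∃ R : ReesAlgebraData S.Y, IsAdmissibleCentre S.f S.i.ker R ∧ R.support = closure ({η} : Set S.Y) ∧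
      ∀ (P : ReesAlgebraData S.Y) (R' : ReesFiltration S.Y), R'.ideal = P.piece → P.IsRegularWeightedCentre →
        (∀ W : S.Y.affineOpens,
          (∀ η' ∈ S.maxSing, η' ≠ η → Disjoint ((W : S.Y.Opens) : Set S.Y) (closure ({η'} : Set S.Y))) →
          ∀ n, (P.piece n).ideal W = (R.piece n).ideal W) →
        ∀ b : ↥R'.plus, R'.πPlus b = η →
          idealOrder (R'.strictTransformPlus S.i.ker) b < idealOrder S.i.ker η := by
  classical
  haveI : IsLocallyNoetherian S.Y := LocallyOfFiniteType.isLocallyNoetherian S.f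
  have hY : Scheme.IsRegular S.Y := Scheme.IsRegular.of_smooth S.f (Scheme.isRegular_Spec (.of k))
  -- A2: the chart at `η`, read on `Y`
  obtain ⟨V, hηV, RV, U, hηU, u, w, ℓ, hchart, hlex, hsuppV, hdropV⟩ :=
    exists_lexMax_chart_of_aqs hAQS₁ S.f S.i.ker η hreg hdim hprinc hne hnot
  set U' : S.Y.Opens := V.ι ''ᵁ (U : (V : Scheme.{0}).Opens) with hU'
  have hηU' : η ∈ U' := ⟨⟨η, hηV⟩, hηU, rfl⟩
  set x : Fin 2 → S.Y.presheaf.stalk η := fun i => (S.Y.presheaf.germ U' η hηU').hom (u i) with hxdef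
  have hspan := hlex.1
  have hwpos := hlex.2.1
  have hw10 := hlex.2.2.2.1
  have hxm : ∀ i, x i ∈ maximalIdeal (S.Y.presheaf.stalk η) := fun i =>
    hspan ▸ Ideal.subset_span (Set.mem_range_self i)
  have h0 : weightedMonomialIdeal x w 0 = ⊤ := weightedMonomialIdeal_zero x w
  have hmul : ∀ a b, weightedMonomialIdeal x w a * weightedMonomialIdeal x w b ≤
      weightedMonomialIdeal x w (a + b) := weightedMonomialIdeal_mul_le x w
  have hprim : ∀ n, ∃ N : ℕ, maximalIdeal (S.Y.presheaf.stalk η) ^ N ≤ weightedMonomialIdeal x w n :=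
    fun n => ⟨n, maximalIdeal_pow_le_weightedMonomialIdeal x w hwpos hspan n⟩
  -- the orbit centre
  let R : ReesAlgebraData S.Y :=
    ReesAlgebraData.ofGermFiltration η (fun n => weightedMonomialIdeal x w n) h0 hmul hprim
  -- A4: regular weighted centre
  have hregc : R.IsRegularWeightedCentre := by
    refine S.isRegularWeightedCentre_ofGermFiltration hInv hη x w (hwpos 1) hw10 hspan h0 hmul hprim ?_ ?_
    · intro a ha hηa
      letI := S.atlas.gradedRing a
      exact OrbitCentreHomogeneous.isHomogeneous_germContractionIdeal_weightedMonomialIdeal hAQS₂ S.f S.i.ker η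
        hreg hdim hprinc hne hnot x w ℓ hlex (S.atlas.W a) hηa (S.atlas.piece a) (S.atlas.isHomogeneous_ker a)
        (hInv.invOrbit a ha η hη hηa).1 (w 0)
    · intro a ha hηa g d hgd hgP hgη hli y hya hyc hgy
      letI := S.atlas.gradedRing a
      exact linearIndependent_toCotangent_of_mem_closure_orbit S.f hY (S.atlas.W a) (S.atlas.piece a) hηa
        (hInv.invOrbit a ha η hη hηa).1 (hInv.invOrbit a ha η hη hηa).2 hdim g d hgd hgP hgη hli y hya hyc hgy
  -- support
  have hsupp : R.support = closure ({η} : Set S.Y) :=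
    support_ofGermFiltration η _ h0 hmul hprim fun n hn =>
      weightedMonomialIdeal_ne_top_of_le x w (maximalIdeal.isMaximal _).ne_top hxm hn
  -- A3: (hom) for all chart gradings
  have hadm : IsAdmissibleCentre S.f S.i.ker R := by
    refine ⟨hregc, hsupp ▸ S.closure_subset_singImage hη.1, ?_⟩
    intro j W 𝒜 _ h𝒜 hX n
    exact OrbitCentreHomogeneous.isHomogeneous_ofGermFiltration_weightedMonomialIdeal_piece_ideal hAQS₂ S.f S.i.ker
      η hη.1 hη.2 hreg hdim hprinc hne hnot x w ℓ hlex h0 hmul hprim j W 𝒜 h𝒜 hX n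
  refine ⟨R, hadm, hsupp, ?_⟩
  -- A5: the drop rider over `η`
  intro P R' hR' hP hloc b hb
  -- an open neighbourhood of `η` missing the other orbit closures
  let C : Set S.Y := ⋃ η' ∈ S.maxSing \ {η}, closure ({η'} : Set S.Y)
  have hC : IsClosed C :=
    (S.maxSing_finite.subset Set.sdiff_subset).isClosed_biUnion fun _ _ => isClosed_closure
  have hηC : η ∉ C := by
    intro h
    obtain ⟨η', hη', hηη'⟩ := Set.mem_iUnion₂.mp h
    exact S.not_mem_closure_of_mem_maxSing hη hη'.1 (fun heq => hη'.2 (heq ▸ rfl : η' ∈ ({η} : Set S.Y))) hηη'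
  -- a basic open `D(h) ∋ η` of the chart `U` inside it
  obtain ⟨h, hhle, hηh⟩ := exists_basicOpen_le_of_mem U (V.ι ⁻¹ᵁ ⟨Cᶜ, hC.isOpen_compl⟩) hηU hηC
  let D : (V : Scheme.{0}).affineOpens := (V : Scheme.{0}).affineBasicOpen h
  have hDU : (D : (V : Scheme.{0}).Opens) ≤ U := (V : Scheme.{0}).basicOpen_le h
  let W : S.Y.affineOpens := ⟨V.ι ''ᵁ (D : (V : Scheme.{0}).Opens), D.2.image_of_isOpenImmersion V.ι⟩
  have hηW : η ∈ (W : S.Y.Opens) := ⟨⟨η, hηV⟩, hηh, rfl⟩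
  have hWdisj : ∀ η' ∈ S.maxSing, η' ≠ η →
      Disjoint ((W : S.Y.Opens) : Set S.Y) (closure ({η'} : Set S.Y)) := by
    intro η' hη' hne'
    rw [Set.disjoint_left]
    rintro _ ⟨z, hz, rfl⟩ hzc
    have hzC : (V.ι.base z : S.Y) ∉ C := hhle hz
    exact hzC (Set.mem_iUnion₂.mpr ⟨η', ⟨hη', hne'⟩, hzc⟩)
  -- the restricted chart on `D(h)` and its reading on `Y`
  have hchartD := isWeightedChart_restrict hchart D hDU
  have hRP : ∀ n, (RV.piece n).ideal D =
      ((P.piece n).ideal W).comap (V.ι.appIso (D : (V : Scheme.{0}).Opens)).inv.hom := by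
    intro n
    have hcomap : ∀ J : Ideal Γ(S.Y, W),
        J.comap (V.ι.appIso (D : (V : Scheme.{0}).Opens)).inv.hom = J := by
      intro J
      rw [Scheme.Opens.ι_appIso]
      exact Ideal.ext fun _ => Iff.rfl
    rw [hcomap, hloc W hWdisj n]
    change (RV.piece n).ideal D = germContractionIdeal η (weightedMonomialIdeal x w n) W
    rw [← germContractionIdeal_image_eq_piece_ideal (fun y => hY y) hchartD hηh hsuppV n]
    congr 2
    funext i
    exact TopCat.Presheaf.germ_res_apply S.Y.presheaf (V.ι.opensFunctor.map (homOfLE hDU)) η hηW (u i)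
  exact DropTransport.idealOrder_strictTransformPlus_lt_of_local_basicOpen P R' hR' S.i.ker η V hηV RV U hdropV
    h hηh hP hRP b hb

end Stage

/-! ## The stub, by name -/

variable {k : Type} [Field k]

/-- **`stub_e1_centre`** (door skeleton v3.6, RUNG tier, BY NAME).  Under `Inv'`, a singular stage carries an
admissible centre supported on the whole of `singImage` whose cobordant blow-up lowers the ORDER of the
hypersurface at every point over every maximal point of `singImage` — MODULO the two vendored
Abramovich–Quek–Schober facts, taken as hypotheses.  The centre is the product over the (finitely many, pairwise
disjoint) orbit closures of the maximal singular points of the orbit centres of `Stage.exists_orbitCentre_of_aqs`;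
the drop at a point over `η ∈ maxSing` is the orbit centre's drop rider, the product agreeing with the orbit
centre near `closure {η}`. [cite: AbramovichQuekSchober2025, Thm 1.3 (1)(3), Thm 3.5] -/
theorem stub_e1_centre (hAQS₁ : AbramovichQuekSchober2025_heightTwoCentre)
    (hAQS₂ : AbramovichQuekSchober2025_separableBaseChange)
    (S : Stage k) (hInv : S.Inv') (hsing : ¬ Scheme.IsRegular S.X) :
    ∃ R : ReesAlgebraData S.Y, IsAdmissibleCentre S.f S.i.ker R ∧ R.support = singImage S.i.ker ∧
      ∀ (R' : ReesFiltration S.Y), R'.ideal = R.piece →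
        ∀ b : ↥R'.plus, R'.πPlus b ∈ S.maxSing →
          idealOrder (R'.strictTransformPlus S.i.ker) b < idealOrder S.i.ker (R'.πPlus b) := by
  obtain ⟨_, _⟩ := S.maxSing_nonempty_iff.mpr hsing -- (the registered hypothesis; not needed below)
  obtain ⟨R, P, hR, -, hadm, hsupp, hloc⟩ :=
    S.exists_isAdmissibleCentre_support_eq_singImage_of_unitCharts_of_forall_exists hInv.invOrbit _
      (fun η hη => by
        obtain ⟨hreg, hdim, hprinc, hne, hnot⟩ := S.aqs_hypotheses_of_mem_maxSing hInv hη
        exact S.exists_orbitCentre_of_aqs hAQS₁ hAQS₂ hInv hη hreg hdim hprinc hne hnot)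
  refine ⟨P, hadm, hsupp, fun R' hR' b hb => ?_⟩
  exact (hR _ hb).2.2 P R' hR' hadm.1 (hloc _ hb) b rfl

end Summit.ResolutionOfSingularities.ResolutionOfSingularities.Theorems.ELadderOne

end
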